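import Summits.QuantumFields.BalabanUV.Beta.FP.TowerK2bDefectDoorGaps

/-!
# `BalabanUV.Beta.FP.TowerK2bDefectStoreySum` — road «FP», binder row D1, ROUTE T (β1): **THE DOOR-GAP RECURSION SOLVED — the END wrapper's Ward defect summed
# against the gauge function is the COMPOSITE-LINEAR-WEIGHTED SUM OF THE DOOR GAPS OF EVERY STOREY, the weights being an2's `compLinKer` BY NAME**
# (road `TowerK2bDefectDoorGaps` (p631115): `Σ_s λ s • R (m+1) ρ′ w s = wM2 • gap_{m+1}(ρ′,w) + Σ_{κ, e ∈ offs} ℓ(ρ′,w; κ, Lc•w+e) • Σ_s λ s • R m κ (Lc•w+e) s`,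
# `Σ_s λ s • R 0 ρ′ w s = wM2 • gap_0(ρ′,w)`; here, for EVERY `m`,
# `Σ_s λ s • R m ρ′ w s = Σ_{j+k=m} Σ_κ Σ_{y ∈ winF (Lc^j) (wid Lc j) w} compLinKer ℓ̃ Lc j (κ,y) (ρ′,w) • (wM2 • [E_λ, L̂_kᵀ·H_{κ,y}·L̂_k] − wM2 • L̂_kᵀ·[E_{rt,k}, H_{κ,y}]·L̂_k)`
# with `ℓ̃ := fun _ ↦ symLinKerAt (ctr 4 Lc) Lc` (the brick of `hRsucc`'s window weights), `compLinKer ℓ̃ Lc j (κ,y) (ρ′,w)` = an2's COMPOSITE LINEAR AVERAGING KERNEL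
# (`CompositeVertexKernelRec`, p-landed: the coefficient of the storey bond `(κ,y)` `j` levels below the top bond `(ρ′,w)`), and the storey-`k` DOOR GAP at the storey bond `(κ,y)`
# in `TowerK2bDefectDoorGaps`' window letters (legs `L̂_k` = `Σ'ₙ compLinKer ℓ̃ Lc (k+1) (x.2, x.1 + M∘n) (b.1, Lc•y+b.2)`, brick `H_{κ,y}` = `symHessKerAt (ctr 4 Lc) Lc κ y` on the window
# bonds, fine generator `E_λ = diagonal (λ ∘ fst)`, brick-level generator `E_{rt,k} = diagonal (λ ∘ ŵ(Lc^(k+1)•(Lc•y+b.2) + Σ_{i<k+1} Lc^i•ctr))`) — i.e. v8∕v9's `Def(λ; β)` at box `n`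
# summed against `λ` IS `Σ_k (composite linear weight β → b) • (wM2 • door gap of storey k at b)`: the sentence of an2's J-NOTE-17 §7 ∕ the ruling packet R-AN2-73-1 §5 (b) ∕ road
# SPEC-63 §2″ («`Σ_s λ s • R n β s = wM2 • Σ_k Σ_{chains β → … → b_k} (∏ ℓ) • gap_k`, the chain sums being composite linear weights (`compLinKer_succ`)») AS ONE KERNEL IDENTITY —
# the right side of SPEC-63's target (T2) in explicit, non-recursive form

WHY (`g49/SPEC-63.md` §2 ∕ §2″; an2 A-3 l.68380, J-NOTE-17 `HOME/b2b-balaban-beta-an2/gen73/J17-DOOR-II.md` §7 ∕ §8; packet `gen73/R-AN2-73-1-PACKET.md` §5 (b)).  `TowerK2bDefectClosed.def_allDepths`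
(p625806) displays the END wrapper's Ward-defect letter `R` by a RECURSION (`hR0 ∕ hRsucc`); `TowerK2bDefectDoorGaps` read one step of it as «`wM2 •` door gap + window-weighted storey
below».  Whoever consumes (T2) — the by-value gate J-NOTE-17 §8 (plants P1∕P2 are storey-level edits), the row's ONE file on a YES ruling (J-NOTE-17 §5), the law owner reading
the packet — wants the SOLVED form: a finite sum over storeys `k ≤ m` of door gaps weighted by the composite linear kernel from the storey bond up to the top bond.  §0 is the
[folklore] unrolling of any such recursion over a CONSTANT brick `ℓ₀` (any blocking `L`, any additive target with an `ℝ`-action): anchor `compLinKer_zero` on the one-point window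
(`mem_winF_zero_iff`), step = `compLinKer_succ` read bottom-up after extending each window one level (`compLinKer_eq_zero` + `mem_winF_succ_of_offs`) and exchanging the finite sums;
§1 instantiates it at `TowerK2bDefectDoorGaps`' letters (pins `hR0 ∕ hRsucc` VERBATIM = `def_allDepths`'; the depth-2 legs `symLinKerAt` are `compLinKer ℓ̃ Lc 1` by
`compLinKer_one` + an2's support letter `symLin_off`, so ONE storey word serves every `k`).  [folklore] induction ∕ reindexing BY NAME over the cell's OWN bookkeeping objects
(`compLinKer`, `winF`, `wid`, `offs`); no `def`, no `def … : Prop`, nothing cited, 0 sorry.  No claim that any door gap or any weighted sum of door gaps vanishes (by value the top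
gap does NOT at n = 0: Engine C K2L-C ∕ K2L-SPLIT ∕ K2L-OVL, float64, zero weight); (J-R₂″) NOT claimed either way; NOTHING typed on the order-2 H-side (ROAD POLICY g49∕g50: no
`hH₂f′`, no `hH′₂f`, no `TowerHN2RowStorey`, no law file before the law owner rules on R-AN2-73-1); the re-posing of #21 (door (ii)) is the law owner's.  Nothing of Bałaban's
asserted, valued or discharged; 0 estimates; 0∕4 row-D1 binders (hW, hR, D1Tel, D1Rep); ROOT M‴ p325680 ∕ P5c ∕ D6 untouched; (L2′) NOT discharged; NOT (C1), NOT (T-ID), NOT D1,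
NEVER «G-an2-4 closed», NOT BetaPertH, NOT continuum, NOT Clay.

HONEST DEPENDENCY (page 1, mandatory): continuum YM on T⁴ ⇐ BetaPertH ∧ nine spine estimates (0/9 proved); BetaPertH ⇐ (D1) ∧ (D4) ∧ CAP+tail;
G-an2-4 gates asym, D1 and NE2/3/4.  HONEST FRAMING (cell contract, verbatim): «discharging `BetaPertH` makes Bałaban's UV stability UNCONDITIONAL —
a real constructive-QFT result; it is NOT the continuum limit and NOT the Clay problem.»  ABSOLUTE RULE (cell charter, verbatim): «No internally-minted
statement may enter as a cited fact. Every hypothesis is either kernel-proved in this package or a verbatim quotation of a PUBLISHED theorem with page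
reference. The manuscript(s) under audit are NOT citable for their own disputed steps — they are the thing under adjudication; programme-internal
(2001/route/tribunal) claims are never citable.»  Road «FP» OWNER, b2b-balaban-beta-d1-p3 gen 50, 2026-08-28.  No existing file touched.
-/

noncomputable section

open scoped BigOperators

namespace Summit.QuantumFields.BalabanUV.Beta.FP.TowerK2bDefectStoreySum

open Finset Matrix
open Literature.MathematicalPhysics.QuantumFieldTheory
open Literature.MathematicalPhysics.QuantumFieldTheory.Balaban1983to89
open Literature.MathematicalPhysics.QuantumFieldTheory.Balaban1983to89.Beta
open B4TorusKernel.MultiPeriod (translate)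
open B6Lemma24Torus (pbox)
open AffineAveraging (Site)
open AveragingHessianKernels (Bond)
open AveragingContoursRooted (ctr)
open BalabanStepW2 (wM2)
open Summit.QuantumFields.BalabanUV.Beta.SymAveragingHessianCounts (symLinKerAt symHessKerAt)
open Summit.QuantumFields.BalabanUV.Beta.CompositeVertexKernelRec (offs winF wid compLinKer compLinKer_zero compLinKer_succ compLinKer_one compLinKer_eq_zero
  mem_winF_zero_iff mem_winF_succ_of_offs)
open Summit.QuantumFields.BalabanUV.Beta.CombMixedT2EvenStoreyTwoLetters (symLin_off)
open Summit.QuantumFields.BalabanUV.Beta.FP.TorusGaugeCovariancePairing (wrapPt)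
open Summit.QuantumFields.BalabanUV.Beta.FP.TowerK2bDefectDoorGaps (sum_smul_R_succ_eq_doorGap sum_smul_R_zero_eq_doorGap)

/-! ## §0 Unrolling a top-peeled window recursion over a constant brick: the weights are `compLinKer` -/

section Generic

variable {d : ℕ} {A : Type*} [AddCommMonoid A] [Module ℝ A]

/-- [folklore] ANCHOR: on the one-point depth-`0` window the `compLinKer … 0`-weighted sum picks the top bond's own value. -/
theorem sum_window_zero_smul (ℓ₀ : Fin (d + 1) → Site (d + 1) → Bond (d + 1) → ℝ) (L : ℕ) (X : Bond (d + 1) → A) (g : Bond (d + 1)) :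
    ∑ κ : Fin (d + 1), ∑ y ∈ winF (L ^ 0) (wid L 0) g.2, compLinKer (fun _ => ℓ₀) L 0 (κ, y) g • X (κ, y) = X g := by
  rw [Finset.sum_eq_single g.1]
  · rw [Finset.sum_eq_single g.2]
    · simp only [compLinKer_zero, Prod.mk.eta, if_true, one_smul]
    · intro y hy hne
      exact absurd (mem_winF_zero_iff.1 hy) hne
    · intro h
      exact (h (mem_winF_zero_iff.2 rfl)).elim
  · intro κ _ hne
    refine Finset.sum_eq_zero fun y _ => ?_
    rw [compLinKer_zero, if_neg (fun h => hne (congrArg Prod.fst h).symm), zero_smul]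
  · intro h
    exact (h (Finset.mem_univ _)).elim

/-- [folklore] WINDOW EXTENSION: a `compLinKer … j`-weighted sum over the depth-`j` window of a window bond `(κ′, L•y + e)` may be taken over the depth-`(j+1)` window of `y`
(the added points carry weight `0`: `compLinKer_eq_zero`, `mem_winF_succ_of_offs`). -/
theorem sum_window_succ_eq (ℓ₀ : Fin (d + 1) → Site (d + 1) → Bond (d + 1) → ℝ) (L : ℕ) (j : ℕ) (κ κ' : Fin (d + 1)) (y e : Site (d + 1)) (he : e ∈ offs L)
    (X : Bond (d + 1) → A) :
    ∑ x ∈ winF (L ^ j) (wid L j) ((L : ℤ) • y + e), compLinKer (fun _ => ℓ₀) L j (κ, x) (κ', (L : ℤ) • y + e) • X (κ, x)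
      = ∑ x ∈ winF (L ^ (j + 1)) (wid L (j + 1)) y, compLinKer (fun _ => ℓ₀) L j (κ, x) (κ', (L : ℤ) • y + e) • X (κ, x) := by
  refine Finset.sum_subset (fun x hx => mem_winF_succ_of_offs he hx) fun x _ hx => ?_
  rw [compLinKer_eq_zero (ℓ := fun _ => ℓ₀) (L := L) j (f := (κ, x)) (g := (κ', (L : ℤ) • y + e)) hx, zero_smul]

/-- [folklore] finite-sum bookkeeping: the window weights enter a triple sum termwise and the two window binders move innermost. -/
theorem sum_smul_sum₃_comm {K E P Q Y : Type*} [Fintype K] [Fintype Q] (O : Finset E) (S : Finset P) (W : P → Finset Y)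
    (a : K → E → ℝ) (b : K → E → P → Q → Y → A) :
    ∑ κ' : K, ∑ e ∈ O, a κ' e • ∑ p ∈ S, ∑ q : Q, ∑ y ∈ W p, b κ' e p q y
      = ∑ p ∈ S, ∑ q : Q, ∑ y ∈ W p, ∑ κ' : K, ∑ e ∈ O, a κ' e • b κ' e p q y := by
  simp only [Finset.smul_sum]
  calc ∑ κ' : K, ∑ e ∈ O, ∑ p ∈ S, ∑ q : Q, ∑ y ∈ W p, a κ' e • b κ' e p q y
      = ∑ κ' : K, ∑ p ∈ S, ∑ e ∈ O, ∑ q : Q, ∑ y ∈ W p, a κ' e • b κ' e p q y :=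
        Finset.sum_congr rfl fun _ _ => Finset.sum_comm
    _ = ∑ p ∈ S, ∑ κ' : K, ∑ e ∈ O, ∑ q : Q, ∑ y ∈ W p, a κ' e • b κ' e p q y := Finset.sum_comm
    _ = ∑ p ∈ S, ∑ κ' : K, ∑ q : Q, ∑ e ∈ O, ∑ y ∈ W p, a κ' e • b κ' e p q y :=
        Finset.sum_congr rfl fun _ _ => Finset.sum_congr rfl fun _ _ => Finset.sum_comm
    _ = ∑ p ∈ S, ∑ q : Q, ∑ κ' : K, ∑ e ∈ O, ∑ y ∈ W p, a κ' e • b κ' e p q y :=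
        Finset.sum_congr rfl fun _ _ => Finset.sum_comm
    _ = ∑ p ∈ S, ∑ q : Q, ∑ κ' : K, ∑ y ∈ W p, ∑ e ∈ O, a κ' e • b κ' e p q y :=
        Finset.sum_congr rfl fun _ _ => Finset.sum_congr rfl fun _ _ => Finset.sum_congr rfl fun _ _ => Finset.sum_comm
    _ = ∑ p ∈ S, ∑ q : Q, ∑ y ∈ W p, ∑ κ' : K, ∑ e ∈ O, a κ' e • b κ' e p q y :=
        Finset.sum_congr rfl fun _ _ => Finset.sum_congr rfl fun _ _ => Finset.sum_comm

/-- [folklore] **`rec_eq_storeySum` — UNROLLING A TOP-PEELED WINDOW RECURSION OVER A CONSTANT BRICK**: if `F 0 = G 0` and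
`F (m+1) g = G (m+1) g + Σ_κ Σ_{e ∈ offs L} ℓ₀ g.1 g.2 (κ, L•g.2+e) • F m (κ, L•g.2+e)` for every `m` and every bond `g`, then for every `m` and `g`
`F m g = Σ_{(j,k) ∈ antidiagonal m} Σ_κ Σ_{y ∈ winF (L^j) (wid L j) g.2} compLinKer (fun _ ↦ ℓ₀) L j (κ,y) g • G k (κ,y)` — the storey-`k` source at the storey bond `(κ,y)`
weighted by an2's composite linear averaging kernel from `(κ,y)` up `j = m − k` levels to `g` (induction on `m`: `Finset.Nat.sum_antidiagonal_succ`, §0's anchor and window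
extension, the exchange `sum_smul_sum₃_comm`, and `compLinKer_succ` read bottom-up). -/
theorem rec_eq_storeySum (ℓ₀ : Fin (d + 1) → Site (d + 1) → Bond (d + 1) → ℝ) (L : ℕ) (F G : ℕ → Bond (d + 1) → A) (h0 : ∀ g, F 0 g = G 0 g)
    (hsucc : ∀ (m : ℕ) (g : Bond (d + 1)), F (m + 1) g = G (m + 1) g
      + ∑ κ : Fin (d + 1), ∑ e ∈ offs L, ℓ₀ g.1 g.2 (κ, (L : ℤ) • g.2 + e) • F m (κ, (L : ℤ) • g.2 + e)) :
    ∀ (m : ℕ) (g : Bond (d + 1)), F m g = ∑ p ∈ antidiagonal m, ∑ κ : Fin (d + 1), ∑ y ∈ winF (L ^ p.1) (wid L p.1) g.2,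
      compLinKer (fun _ => ℓ₀) L p.1 (κ, y) g • G p.2 (κ, y)
  | 0, g => by
      rw [h0, Finset.Nat.antidiagonal_zero, Finset.sum_singleton]
      exact (sum_window_zero_smul ℓ₀ L (G 0) g).symm
  | m + 1, g => by
      rw [hsucc, Finset.Nat.sum_antidiagonal_succ]
      dsimp only
      rw [sum_window_zero_smul]
      congr 1
      have hIH : ∀ (κ' : Fin (d + 1)) (e : Site (d + 1)), e ∈ offs L →
          ℓ₀ g.1 g.2 (κ', (L : ℤ) • g.2 + e) • F m (κ', (L : ℤ) • g.2 + e)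
            = ℓ₀ g.1 g.2 (κ', (L : ℤ) • g.2 + e) • ∑ p ∈ antidiagonal m, ∑ κ : Fin (d + 1), ∑ y ∈ winF (L ^ (p.1 + 1)) (wid L (p.1 + 1)) g.2,
                compLinKer (fun _ => ℓ₀) L p.1 (κ, y) (κ', (L : ℤ) • g.2 + e) • G p.2 (κ, y) := by
        intro κ' e he
        rw [rec_eq_storeySum ℓ₀ L F G h0 hsucc m]
        exact congrArg _ (Finset.sum_congr rfl fun p _ => Finset.sum_congr rfl fun κ _ => sum_window_succ_eq ℓ₀ L p.1 κ κ' g.2 e he (G p.2))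
      rw [Finset.sum_congr rfl fun κ' _ => Finset.sum_congr rfl fun e he => hIH κ' e he]
      refine (sum_smul_sum₃_comm (offs L) (antidiagonal m) (fun p => winF (L ^ (p.1 + 1)) (wid L (p.1 + 1)) g.2)
        (fun κ' e => ℓ₀ g.1 g.2 (κ', (L : ℤ) • g.2 + e))
        (fun κ' e p κ y => compLinKer (fun _ => ℓ₀) L p.1 (κ, y) (κ', (L : ℤ) • g.2 + e) • G p.2 (κ, y))).trans ?_
      refine Finset.sum_congr rfl fun p _ => Finset.sum_congr rfl fun κ _ => Finset.sum_congr rfl fun y _ => ?_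
      rw [compLinKer_succ, Finset.sum_smul]
      refine Finset.sum_congr rfl fun κ' _ => ?_
      rw [Finset.sum_smul]
      exact Finset.sum_congr rfl fun e _ => smul_smul _ _ _

end Generic

/-! ## §1 At `TowerK2bDefectDoorGaps`' letters: the END wrapper's defect summed against `λ` is the weighted sum of every storey's door gap -/

section StoreySum

variable {Lc : ℕ} [NeZero Lc] {M : Fin (3 + 1) → ℕ} [∀ μ, NeZero (M μ)] (L₂ j : ℕ)

/-- [folklore] **`sum_smul_R_eq_storeySum` — THE END WRAPPER's WARD DEFECT SUMMED AGAINST THE GAUGE FUNCTION IS THE COMPOSITE-LINEAR-WEIGHTED SUM OF THE DOOR GAPS OF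
EVERY STOREY.**  For the remainder letter `R` of `TowerK2bDefectClosed.def_allDepths` (pins `hR0 ∕ hRsucc` verbatim), every `m`, every coarse bond `(ρ′, w)` and every torus
gauge function `λ`:  `Σ_s λ s • R m ρ′ w s = Σ_{(j,k) : j+k=m} Σ_κ Σ_{y ∈ winF (Lc^j) (wid Lc j) w} compLinKer ℓ̃ Lc j (κ,y) (ρ′,w) • (wM2 • (E_λ·L̂ᵀHL̂ − L̂ᵀHL̂·E_λ) − wM2 • L̂ᵀ·(E_rt·H − H·E_rt)·L̂)`,
the bracket being the storey-`k` DOOR GAP at the storey bond `(κ, y)` («fine door of the transported brick» minus «transported brick-level door»: legs `L̂ = Matrix.of (b, x) ↦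
Σ'ₙ compLinKer ℓ̃ Lc (k+1) (x.2, x.1 + M∘n) (b.1, Lc•y + b.2)`, brick `H = Matrix.of (b₁, b₂) ↦ symHessKerAt (ctr 4 Lc) Lc κ y (b₁.1, Lc•y+b₁.2) (b₂.1, Lc•y+b₂.2)`, `E_λ = diagonal (λ ∘ fst)`,
`E_rt = diagonal (b ↦ λ (ŵ(Lc^(k+1)•(Lc•y + b.2) + Σ_{i<k+1} Lc^i•ctr)))`) and `ℓ̃ = fun _ ↦ symLinKerAt (ctr 4 Lc) Lc` — §0 `rec_eq_storeySum` at `F m (κ,y) := Σ_s λ s • R m κ y s`,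
`G k (κ,y) :=` the bracket, `h0` = `TowerK2bDefectDoorGaps.sum_smul_R_zero_eq_doorGap` (legs `symLinKerAt = compLinKer ℓ̃ Lc 1` by `compLinKer_one symLin_off`), `hsucc` =
`TowerK2bDefectDoorGaps.sum_smul_R_succ_eq_doorGap`.  (At `(j,k) = (0,m)` the weight is `δ`: the top storey's own gap; no claim that any term vanishes.) -/
theorem sum_smul_R_eq_storeySum
    (R : ℕ → Fin (3 + 1) → Site (3 + 1) → ↥(pbox M) → Matrix (↥(pbox M) × Fin (3 + 1)) (↥(pbox M) × Fin (3 + 1)) ℝ)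
    (hR0 : ∀ (ρ' : Fin (3 + 1)) (w : Site (3 + 1)) (s : ↥(pbox M)), R 0 ρ' w s
      = wM2 3 L₂ j • ∑ κ₁ : Fin (3 + 1), ∑ e₁ ∈ offs Lc, ∑ κ₂ : Fin (3 + 1), ∑ e₂ ∈ offs Lc,
            symHessKerAt (ctr 4 Lc) Lc ρ' w (κ₁, (Lc : ℤ) • w + e₁) (κ₂, (Lc : ℤ) • w + e₂) •
              (Matrix.vecMulVec
                  (fun x : ↥(pbox M) × Fin (3 + 1) => ((if x.1 = s then (1 : ℝ) else 0) - (if wrapPt M ((Lc : ℤ) • ((Lc : ℤ) • w + e₁) + ctr 4 Lc) = s then (1 : ℝ) else 0))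
                    * ∑' n : Site (3 + 1), symLinKerAt (ctr 4 Lc) Lc κ₁ ((Lc : ℤ) • w + e₁) (x.2, translate M (x.1 : Site (3 + 1)) n))
                  (fun z : ↥(pbox M) × Fin (3 + 1) => ∑' n : Site (3 + 1), symLinKerAt (ctr 4 Lc) Lc κ₂ ((Lc : ℤ) • w + e₂) (z.2, translate M (z.1 : Site (3 + 1)) n))
                - Matrix.vecMulVec
                  (fun x : ↥(pbox M) × Fin (3 + 1) => ∑' n : Site (3 + 1), symLinKerAt (ctr 4 Lc) Lc κ₁ ((Lc : ℤ) • w + e₁) (x.2, translate M (x.1 : Site (3 + 1)) n))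
                  (fun z : ↥(pbox M) × Fin (3 + 1) => ((if z.1 = s then (1 : ℝ) else 0) - (if wrapPt M ((Lc : ℤ) • ((Lc : ℤ) • w + e₂) + ctr 4 Lc) = s then (1 : ℝ) else 0))
                    * ∑' n : Site (3 + 1), symLinKerAt (ctr 4 Lc) Lc κ₂ ((Lc : ℤ) • w + e₂) (z.2, translate M (z.1 : Site (3 + 1)) n))))
    (hRsucc : ∀ (m : ℕ) (ρ' : Fin (3 + 1)) (w : Site (3 + 1)) (s : ↥(pbox M)), R (m + 1) ρ' w s
      = wM2 3 L₂ j • (∑ κ₁ : Fin (3 + 1), ∑ e₁ ∈ offs Lc, ∑ κ₂ : Fin (3 + 1), ∑ e₂ ∈ offs Lc,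
            symHessKerAt (ctr 4 Lc) Lc ρ' w (κ₁, (Lc : ℤ) • w + e₁) (κ₂, (Lc : ℤ) • w + e₂) •
              (Matrix.vecMulVec
                  (fun x : ↥(pbox M) × Fin (3 + 1) => ((if x.1 = s then (1 : ℝ) else 0)
                      - (if wrapPt M (((Lc ^ (m + 1 + 1) : ℕ) : ℤ) • ((Lc : ℤ) • w + e₁) + ∑ k ∈ Finset.range (m + 1 + 1), ((Lc ^ k : ℕ) : ℤ) • ctr 4 Lc) = s then (1 : ℝ) else 0))
                    * ∑' n : Site (3 + 1), compLinKer (fun _ => symLinKerAt (ctr 4 Lc) Lc) Lc (m + 1 + 1) (x.2, translate M (x.1 : Site (3 + 1)) n) (κ₁, (Lc : ℤ) • w + e₁))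
                  (fun z : ↥(pbox M) × Fin (3 + 1) => ∑' n : Site (3 + 1),
                    compLinKer (fun _ => symLinKerAt (ctr 4 Lc) Lc) Lc (m + 1 + 1) (z.2, translate M (z.1 : Site (3 + 1)) n) (κ₂, (Lc : ℤ) • w + e₂))
                - Matrix.vecMulVec
                  (fun x : ↥(pbox M) × Fin (3 + 1) => ∑' n : Site (3 + 1),
                    compLinKer (fun _ => symLinKerAt (ctr 4 Lc) Lc) Lc (m + 1 + 1) (x.2, translate M (x.1 : Site (3 + 1)) n) (κ₁, (Lc : ℤ) • w + e₁))
                  (fun z : ↥(pbox M) × Fin (3 + 1) => ((if z.1 = s then (1 : ℝ) else 0)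
                      - (if wrapPt M (((Lc ^ (m + 1 + 1) : ℕ) : ℤ) • ((Lc : ℤ) • w + e₂) + ∑ k ∈ Finset.range (m + 1 + 1), ((Lc ^ k : ℕ) : ℤ) • ctr 4 Lc) = s then (1 : ℝ) else 0))
                    * ∑' n : Site (3 + 1), compLinKer (fun _ => symLinKerAt (ctr 4 Lc) Lc) Lc (m + 1 + 1) (z.2, translate M (z.1 : Site (3 + 1)) n) (κ₂, (Lc : ℤ) • w + e₂))))
        + ∑ κ : Fin (3 + 1), ∑ e ∈ offs Lc, symLinKerAt (ctr 4 Lc) Lc ρ' w (κ, (Lc : ℤ) • w + e) • R m κ ((Lc : ℤ) • w + e) s)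
    (m : ℕ) (ρ' : Fin (3 + 1)) (w : Site (3 + 1)) (lam : ↥(pbox M) → ℝ) :
    ∑ s : ↥(pbox M), lam s • R m ρ' w s
      = ∑ p ∈ antidiagonal m, ∑ κ : Fin (3 + 1), ∑ y ∈ winF (Lc ^ p.1) (wid Lc p.1) w,
          compLinKer (fun _ => symLinKerAt (ctr 4 Lc) Lc) Lc p.1 (κ, y) (ρ', w) •
           (wM2 3 L₂ j • (Matrix.diagonal (fun x : ↥(pbox M) × Fin (3 + 1) => lam x.1)
              * ((Matrix.of fun (b : Fin (3 + 1) × ↥(offs (d := 3) Lc)) (x : ↥(pbox M) × Fin (3 + 1)) => ∑' n : Site (3 + 1),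
                    compLinKer (fun _ => symLinKerAt (ctr 4 Lc) Lc) Lc (p.2 + 1) (x.2, translate M (x.1 : Site (3 + 1)) n) (b.1, (Lc : ℤ) • y + (b.2 : Site (3 + 1))))ᵀ
                * Matrix.of (fun b₁ b₂ : Fin (3 + 1) × ↥(offs (d := 3) Lc) =>
                    symHessKerAt (ctr 4 Lc) Lc κ y (b₁.1, (Lc : ℤ) • y + (b₁.2 : Site (3 + 1))) (b₂.1, (Lc : ℤ) • y + (b₂.2 : Site (3 + 1))))
                * Matrix.of fun (b : Fin (3 + 1) × ↥(offs (d := 3) Lc)) (x : ↥(pbox M) × Fin (3 + 1)) => ∑' n : Site (3 + 1),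
                    compLinKer (fun _ => symLinKerAt (ctr 4 Lc) Lc) Lc (p.2 + 1) (x.2, translate M (x.1 : Site (3 + 1)) n) (b.1, (Lc : ℤ) • y + (b.2 : Site (3 + 1))))
            - ((Matrix.of fun (b : Fin (3 + 1) × ↥(offs (d := 3) Lc)) (x : ↥(pbox M) × Fin (3 + 1)) => ∑' n : Site (3 + 1),
                    compLinKer (fun _ => symLinKerAt (ctr 4 Lc) Lc) Lc (p.2 + 1) (x.2, translate M (x.1 : Site (3 + 1)) n) (b.1, (Lc : ℤ) • y + (b.2 : Site (3 + 1))))ᵀ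
                * Matrix.of (fun b₁ b₂ : Fin (3 + 1) × ↥(offs (d := 3) Lc) =>
                    symHessKerAt (ctr 4 Lc) Lc κ y (b₁.1, (Lc : ℤ) • y + (b₁.2 : Site (3 + 1))) (b₂.1, (Lc : ℤ) • y + (b₂.2 : Site (3 + 1))))
                * Matrix.of fun (b : Fin (3 + 1) × ↥(offs (d := 3) Lc)) (x : ↥(pbox M) × Fin (3 + 1)) => ∑' n : Site (3 + 1),
                    compLinKer (fun _ => symLinKerAt (ctr 4 Lc) Lc) Lc (p.2 + 1) (x.2, translate M (x.1 : Site (3 + 1)) n) (b.1, (Lc : ℤ) • y + (b.2 : Site (3 + 1))))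
              * Matrix.diagonal (fun x : ↥(pbox M) × Fin (3 + 1) => lam x.1))
          - wM2 3 L₂ j • ((Matrix.of fun (b : Fin (3 + 1) × ↥(offs (d := 3) Lc)) (x : ↥(pbox M) × Fin (3 + 1)) => ∑' n : Site (3 + 1),
                    compLinKer (fun _ => symLinKerAt (ctr 4 Lc) Lc) Lc (p.2 + 1) (x.2, translate M (x.1 : Site (3 + 1)) n) (b.1, (Lc : ℤ) • y + (b.2 : Site (3 + 1))))ᵀ
            * (Matrix.diagonal (fun b : Fin (3 + 1) × ↥(offs (d := 3) Lc) =>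
                  lam (wrapPt M (((Lc ^ (p.2 + 1) : ℕ) : ℤ) • ((Lc : ℤ) • y + (b.2 : Site (3 + 1))) + ∑ i ∈ Finset.range (p.2 + 1), ((Lc ^ i : ℕ) : ℤ) • ctr 4 Lc)))
                * Matrix.of (fun b₁ b₂ : Fin (3 + 1) × ↥(offs (d := 3) Lc) =>
                    symHessKerAt (ctr 4 Lc) Lc κ y (b₁.1, (Lc : ℤ) • y + (b₁.2 : Site (3 + 1))) (b₂.1, (Lc : ℤ) • y + (b₂.2 : Site (3 + 1))))
              - Matrix.of (fun b₁ b₂ : Fin (3 + 1) × ↥(offs (d := 3) Lc) =>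
                    symHessKerAt (ctr 4 Lc) Lc κ y (b₁.1, (Lc : ℤ) • y + (b₁.2 : Site (3 + 1))) (b₂.1, (Lc : ℤ) • y + (b₂.2 : Site (3 + 1))))
                * Matrix.diagonal (fun b : Fin (3 + 1) × ↥(offs (d := 3) Lc) =>
                  lam (wrapPt M (((Lc ^ (p.2 + 1) : ℕ) : ℤ) • ((Lc : ℤ) • y + (b.2 : Site (3 + 1))) + ∑ i ∈ Finset.range (p.2 + 1), ((Lc ^ i : ℕ) : ℤ) • ctr 4 Lc))))
            * Matrix.of fun (b : Fin (3 + 1) × ↥(offs (d := 3) Lc)) (x : ↥(pbox M) × Fin (3 + 1)) => ∑' n : Site (3 + 1),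
                    compLinKer (fun _ => symLinKerAt (ctr 4 Lc) Lc) Lc (p.2 + 1) (x.2, translate M (x.1 : Site (3 + 1)) n) (b.1, (Lc : ℤ) • y + (b.2 : Site (3 + 1))))) := by
  -- the storey-`k` door-gap word at the storey bond `g = (κ, y)`, as a function of `(k, g)` (the `G` of §0)
  have h0 : ∀ g : Bond (3 + 1), (∑ s : ↥(pbox M), lam s • R 0 g.1 g.2 s)
      = wM2 3 L₂ j • (Matrix.diagonal (fun x : ↥(pbox M) × Fin (3 + 1) => lam x.1)
              * ((Matrix.of fun (b : Fin (3 + 1) × ↥(offs (d := 3) Lc)) (x : ↥(pbox M) × Fin (3 + 1)) => ∑' n : Site (3 + 1),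
                    compLinKer (fun _ => symLinKerAt (ctr 4 Lc) Lc) Lc (0 + 1) (x.2, translate M (x.1 : Site (3 + 1)) n) (b.1, (Lc : ℤ) • g.2 + (b.2 : Site (3 + 1))))ᵀ
                * Matrix.of (fun b₁ b₂ : Fin (3 + 1) × ↥(offs (d := 3) Lc) =>
                    symHessKerAt (ctr 4 Lc) Lc g.1 g.2 (b₁.1, (Lc : ℤ) • g.2 + (b₁.2 : Site (3 + 1))) (b₂.1, (Lc : ℤ) • g.2 + (b₂.2 : Site (3 + 1))))
                * Matrix.of fun (b : Fin (3 + 1) × ↥(offs (d := 3) Lc)) (x : ↥(pbox M) × Fin (3 + 1)) => ∑' n : Site (3 + 1),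
                    compLinKer (fun _ => symLinKerAt (ctr 4 Lc) Lc) Lc (0 + 1) (x.2, translate M (x.1 : Site (3 + 1)) n) (b.1, (Lc : ℤ) • g.2 + (b.2 : Site (3 + 1))))
            - ((Matrix.of fun (b : Fin (3 + 1) × ↥(offs (d := 3) Lc)) (x : ↥(pbox M) × Fin (3 + 1)) => ∑' n : Site (3 + 1),
                    compLinKer (fun _ => symLinKerAt (ctr 4 Lc) Lc) Lc (0 + 1) (x.2, translate M (x.1 : Site (3 + 1)) n) (b.1, (Lc : ℤ) • g.2 + (b.2 : Site (3 + 1))))ᵀ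
                * Matrix.of (fun b₁ b₂ : Fin (3 + 1) × ↥(offs (d := 3) Lc) =>
                    symHessKerAt (ctr 4 Lc) Lc g.1 g.2 (b₁.1, (Lc : ℤ) • g.2 + (b₁.2 : Site (3 + 1))) (b₂.1, (Lc : ℤ) • g.2 + (b₂.2 : Site (3 + 1))))
                * Matrix.of fun (b : Fin (3 + 1) × ↥(offs (d := 3) Lc)) (x : ↥(pbox M) × Fin (3 + 1)) => ∑' n : Site (3 + 1),
                    compLinKer (fun _ => symLinKerAt (ctr 4 Lc) Lc) Lc (0 + 1) (x.2, translate M (x.1 : Site (3 + 1)) n) (b.1, (Lc : ℤ) • g.2 + (b.2 : Site (3 + 1))))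
              * Matrix.diagonal (fun x : ↥(pbox M) × Fin (3 + 1) => lam x.1))
          - wM2 3 L₂ j • ((Matrix.of fun (b : Fin (3 + 1) × ↥(offs (d := 3) Lc)) (x : ↥(pbox M) × Fin (3 + 1)) => ∑' n : Site (3 + 1),
                    compLinKer (fun _ => symLinKerAt (ctr 4 Lc) Lc) Lc (0 + 1) (x.2, translate M (x.1 : Site (3 + 1)) n) (b.1, (Lc : ℤ) • g.2 + (b.2 : Site (3 + 1))))ᵀ
            * (Matrix.diagonal (fun b : Fin (3 + 1) × ↥(offs (d := 3) Lc) =>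
                  lam (wrapPt M (((Lc ^ (0 + 1) : ℕ) : ℤ) • ((Lc : ℤ) • g.2 + (b.2 : Site (3 + 1))) + ∑ i ∈ Finset.range (0 + 1), ((Lc ^ i : ℕ) : ℤ) • ctr 4 Lc)))
                * Matrix.of (fun b₁ b₂ : Fin (3 + 1) × ↥(offs (d := 3) Lc) =>
                    symHessKerAt (ctr 4 Lc) Lc g.1 g.2 (b₁.1, (Lc : ℤ) • g.2 + (b₁.2 : Site (3 + 1))) (b₂.1, (Lc : ℤ) • g.2 + (b₂.2 : Site (3 + 1))))
              - Matrix.of (fun b₁ b₂ : Fin (3 + 1) × ↥(offs (d := 3) Lc) =>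
                    symHessKerAt (ctr 4 Lc) Lc g.1 g.2 (b₁.1, (Lc : ℤ) • g.2 + (b₁.2 : Site (3 + 1))) (b₂.1, (Lc : ℤ) • g.2 + (b₂.2 : Site (3 + 1))))
                * Matrix.diagonal (fun b : Fin (3 + 1) × ↥(offs (d := 3) Lc) =>
                  lam (wrapPt M (((Lc ^ (0 + 1) : ℕ) : ℤ) • ((Lc : ℤ) • g.2 + (b.2 : Site (3 + 1))) + ∑ i ∈ Finset.range (0 + 1), ((Lc ^ i : ℕ) : ℤ) • ctr 4 Lc))))
            * Matrix.of fun (b : Fin (3 + 1) × ↥(offs (d := 3) Lc)) (x : ↥(pbox M) × Fin (3 + 1)) => ∑' n : Site (3 + 1),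
                    compLinKer (fun _ => symLinKerAt (ctr 4 Lc) Lc) Lc (0 + 1) (x.2, translate M (x.1 : Site (3 + 1)) n) (b.1, (Lc : ℤ) • g.2 + (b.2 : Site (3 + 1)))) := by
    intro g
    simp only [zero_add, compLinKer_one (symLin_off (Lc := Lc)), pow_one, Finset.range_one, Finset.sum_singleton, pow_zero, Nat.cast_one, one_smul]
    rw [← smul_sub]
    exact sum_smul_R_zero_eq_doorGap L₂ j R hR0 g.1 g.2 lam
  exact rec_eq_storeySum (symLinKerAt (ctr 4 Lc) Lc) Lc
    (fun m (g : Bond (3 + 1)) => ∑ s : ↥(pbox M), lam s • R m g.1 g.2 s)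
    (fun k (g : Bond (3 + 1)) => wM2 3 L₂ j • (Matrix.diagonal (fun x : ↥(pbox M) × Fin (3 + 1) => lam x.1)
              * ((Matrix.of fun (b : Fin (3 + 1) × ↥(offs (d := 3) Lc)) (x : ↥(pbox M) × Fin (3 + 1)) => ∑' n : Site (3 + 1),
                    compLinKer (fun _ => symLinKerAt (ctr 4 Lc) Lc) Lc (k + 1) (x.2, translate M (x.1 : Site (3 + 1)) n) (b.1, (Lc : ℤ) • g.2 + (b.2 : Site (3 + 1))))ᵀ
                * Matrix.of (fun b₁ b₂ : Fin (3 + 1) × ↥(offs (d := 3) Lc) =>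
                    symHessKerAt (ctr 4 Lc) Lc g.1 g.2 (b₁.1, (Lc : ℤ) • g.2 + (b₁.2 : Site (3 + 1))) (b₂.1, (Lc : ℤ) • g.2 + (b₂.2 : Site (3 + 1))))
                * Matrix.of fun (b : Fin (3 + 1) × ↥(offs (d := 3) Lc)) (x : ↥(pbox M) × Fin (3 + 1)) => ∑' n : Site (3 + 1),
                    compLinKer (fun _ => symLinKerAt (ctr 4 Lc) Lc) Lc (k + 1) (x.2, translate M (x.1 : Site (3 + 1)) n) (b.1, (Lc : ℤ) • g.2 + (b.2 : Site (3 + 1))))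
            - ((Matrix.of fun (b : Fin (3 + 1) × ↥(offs (d := 3) Lc)) (x : ↥(pbox M) × Fin (3 + 1)) => ∑' n : Site (3 + 1),
                    compLinKer (fun _ => symLinKerAt (ctr 4 Lc) Lc) Lc (k + 1) (x.2, translate M (x.1 : Site (3 + 1)) n) (b.1, (Lc : ℤ) • g.2 + (b.2 : Site (3 + 1))))ᵀ
                * Matrix.of (fun b₁ b₂ : Fin (3 + 1) × ↥(offs (d := 3) Lc) =>
                    symHessKerAt (ctr 4 Lc) Lc g.1 g.2 (b₁.1, (Lc : ℤ) • g.2 + (b₁.2 : Site (3 + 1))) (b₂.1, (Lc : ℤ) • g.2 + (b₂.2 : Site (3 + 1))))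
                * Matrix.of fun (b : Fin (3 + 1) × ↥(offs (d := 3) Lc)) (x : ↥(pbox M) × Fin (3 + 1)) => ∑' n : Site (3 + 1),
                    compLinKer (fun _ => symLinKerAt (ctr 4 Lc) Lc) Lc (k + 1) (x.2, translate M (x.1 : Site (3 + 1)) n) (b.1, (Lc : ℤ) • g.2 + (b.2 : Site (3 + 1))))
              * Matrix.diagonal (fun x : ↥(pbox M) × Fin (3 + 1) => lam x.1))
          - wM2 3 L₂ j • ((Matrix.of fun (b : Fin (3 + 1) × ↥(offs (d := 3) Lc)) (x : ↥(pbox M) × Fin (3 + 1)) => ∑' n : Site (3 + 1),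
                    compLinKer (fun _ => symLinKerAt (ctr 4 Lc) Lc) Lc (k + 1) (x.2, translate M (x.1 : Site (3 + 1)) n) (b.1, (Lc : ℤ) • g.2 + (b.2 : Site (3 + 1))))ᵀ
            * (Matrix.diagonal (fun b : Fin (3 + 1) × ↥(offs (d := 3) Lc) =>
                  lam (wrapPt M (((Lc ^ (k + 1) : ℕ) : ℤ) • ((Lc : ℤ) • g.2 + (b.2 : Site (3 + 1))) + ∑ i ∈ Finset.range (k + 1), ((Lc ^ i : ℕ) : ℤ) • ctr 4 Lc)))
                * Matrix.of (fun b₁ b₂ : Fin (3 + 1) × ↥(offs (d := 3) Lc) =>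
                    symHessKerAt (ctr 4 Lc) Lc g.1 g.2 (b₁.1, (Lc : ℤ) • g.2 + (b₁.2 : Site (3 + 1))) (b₂.1, (Lc : ℤ) • g.2 + (b₂.2 : Site (3 + 1))))
              - Matrix.of (fun b₁ b₂ : Fin (3 + 1) × ↥(offs (d := 3) Lc) =>
                    symHessKerAt (ctr 4 Lc) Lc g.1 g.2 (b₁.1, (Lc : ℤ) • g.2 + (b₁.2 : Site (3 + 1))) (b₂.1, (Lc : ℤ) • g.2 + (b₂.2 : Site (3 + 1))))
                * Matrix.diagonal (fun b : Fin (3 + 1) × ↥(offs (d := 3) Lc) =>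
                  lam (wrapPt M (((Lc ^ (k + 1) : ℕ) : ℤ) • ((Lc : ℤ) • g.2 + (b.2 : Site (3 + 1))) + ∑ i ∈ Finset.range (k + 1), ((Lc ^ i : ℕ) : ℤ) • ctr 4 Lc))))
            * Matrix.of fun (b : Fin (3 + 1) × ↥(offs (d := 3) Lc)) (x : ↥(pbox M) × Fin (3 + 1)) => ∑' n : Site (3 + 1),
                    compLinKer (fun _ => symLinKerAt (ctr 4 Lc) Lc) Lc (k + 1) (x.2, translate M (x.1 : Site (3 + 1)) n) (b.1, (Lc : ℤ) • g.2 + (b.2 : Site (3 + 1)))))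
    h0 (fun k g => sum_smul_R_succ_eq_doorGap L₂ j R hRsucc k g.1 g.2 lam) m (ρ', w)

end StoreySum

end Summit.QuantumFields.BalabanUV.Beta.FP.TowerK2bDefectStoreySum

end
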